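import Mathlib
import HarnessLib

/-!
# Ribbon rarity — elementary counting: grid points in discs and shells, bounded-degree walks
# (crux `MagicFormulaT`, line `Sketch` v7, sub-goals of `stub_ribbonRarity`)

Crux `Summit.CriticalPhenomena.CardyFormulaZ2.Theses.CardyMagicRigidity.MagicFormulaT`
(stmt-CriticalPhenomena-4836), line `Sketch`, skeleton v7.  The Peierls ("ribbon rarity") step bounds the
probability that two distinct macroscopic interface loops are globally `2ε`-close by
`(#roots) × (#skeleton paths of length k from a root) × (four-arm cost)^k`.  This file supplies the three
purely combinatorial counting inputs (registered sub-goals, Mathlib only):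

* `ribbon_gridBallCount` — the grid `ε ℤ² ⊂ ℂ` has at most `(2ρ/ε + 3)²` points in the closed disc of
  radius `ρ` about `0` (the number of roots; box count);
* `ribbon_shellCount` — for `M ≥ 3` the grid has at most `40 M` points at distance `∈ [(M-1)ε, (M+1)ε]`
  from an arbitrary point `p` (the out-degree of the shell adjacency — a genuinely one-dimensional
  entropy).  Proof by area: the half-open mesh cells `[xε,(x+1)ε) × [yε,(y+1)ε)` attached to these points
  are pairwise disjoint, have area `ε²`, and lie in the annulus `{(M-3)ε ≤ |z - p| ≤ (M+3)ε}` of area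
  `π((M+3)² - (M-3)²)ε² = 12πMε² < 40Mε²`;
* `ribbon_walkCount` — the number of sequences `p₀ = v₀, p₁, …, p_k` with `p_{i+1} ∈ nbr(p_i)` and all
  `|nbr(v)| ≤ Δ` is at most `Δ^k` (induction on `k`, peeling off the last step).
-/

noncomputable section

namespace Summit.CriticalPhenomena.CardyFormulaZ2.Cruxes.MagicFormulaT.LineSketch

open MeasureTheory Set Metric
open scoped Real BigOperators ENNReal

/-! ### The grid `ε ℤ²` as the image of the index map `ℤ × ℤ → ℂ` -/

/-- Real part of the grid point `ε (x + y i)`. -/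
private lemma grid_re (ε : ℝ) (x y : ℤ) : ((ε * (x + y * Complex.I) : ℂ)).re = ε * x := by
  simp

/-- Imaginary part of the grid point `ε (x + y i)`. -/
private lemma grid_im (ε : ℝ) (x y : ℤ) : ((ε * (x + y * Complex.I) : ℂ)).im = ε * y := by
  simp

/-- The grid `ε ℤ²` cut out by a predicate is the image under the index map of the corresponding
index set. -/
private lemma grid_setOf_eq_image (ε : ℝ) (P : ℂ → Prop) :
    {q : ℂ | (∃ x y : ℤ, q = ε * (x + y * Complex.I)) ∧ P q} =
      (fun xy : ℤ × ℤ => (ε * (xy.1 + xy.2 * Complex.I) : ℂ)) ''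
        {xy : ℤ × ℤ | P (ε * (xy.1 + xy.2 * Complex.I))} := by
  ext q
  simp only [mem_setOf_eq, mem_image, Prod.exists]
  constructor
  · rintro ⟨⟨x, y, rfl⟩, hq⟩
    exact ⟨x, y, hq, rfl⟩
  · rintro ⟨x, y, hq, rfl⟩
    exact ⟨⟨x, y, rfl⟩, hq⟩

/-- The index map `(x, y) ↦ ε (x + y i)` is injective for `ε > 0`. -/
private lemma grid_injective {ε : ℝ} (hε : 0 < ε) :
    Function.Injective (fun xy : ℤ × ℤ => (ε * (xy.1 + xy.2 * Complex.I) : ℂ)) := by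
  intro a b h
  have h1 := congrArg Complex.re h
  have h2 := congrArg Complex.im h
  simp only [grid_re, grid_im] at h1 h2
  refine Prod.ext ?_ ?_
  · exact_mod_cast mul_left_cancel₀ hε.ne' h1
  · exact_mod_cast mul_left_cancel₀ hε.ne' h2

/-- The coordinates of a grid point within distance `R` of `p` are at most `(‖p‖ + R) / ε` in absolute
value. -/
private lemma abs_le_of_dist_le {ε : ℝ} (hε : 0 < ε) (p : ℂ) (R : ℝ) (x y : ℤ)
    (h : dist p (ε * (x + y * Complex.I)) ≤ R) :
    |(x : ℝ)| ≤ (‖p‖ + R) / ε ∧ |(y : ℝ)| ≤ (‖p‖ + R) / ε := by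
  have hnorm : ‖(ε * (x + y * Complex.I) : ℂ)‖ ≤ ‖p‖ + R := by
    have h1 := dist_triangle (ε * (x + y * Complex.I) : ℂ) p 0
    rw [dist_zero_right, dist_zero_right, dist_comm] at h1
    linarith
  have hre := Complex.abs_re_le_norm (ε * (x + y * Complex.I) : ℂ)
  have him := Complex.abs_im_le_norm (ε * (x + y * Complex.I) : ℂ)
  rw [grid_re, abs_mul, abs_of_pos hε] at hre
  rw [grid_im, abs_mul, abs_of_pos hε] at him
  rw [le_div_iff₀ hε, le_div_iff₀ hε]
  constructor <;> linarith

/-- Index pairs whose grid point is within distance `R` of `p` form a finite set (they lie in a box). -/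
private lemma indexSet_finite {ε : ℝ} (hε : 0 < ε) (p : ℂ) (R : ℝ) :
    {xy : ℤ × ℤ | dist p (ε * (xy.1 + xy.2 * Complex.I)) ≤ R}.Finite := by
  set N : ℕ := ⌈(‖p‖ + R) / ε⌉₊ with hN
  refine (Finset.finite_toSet (Finset.Icc (-(N : ℤ)) N ×ˢ Finset.Icc (-(N : ℤ)) N)).subset ?_
  rintro ⟨x, y⟩ hxy
  obtain ⟨hx, hy⟩ := abs_le_of_dist_le hε p R x y hxy
  have hxN : |(x : ℝ)| ≤ N := hx.trans (Nat.le_ceil _)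
  have hyN : |(y : ℝ)| ≤ N := hy.trans (Nat.le_ceil _)
  rw [abs_le] at hxN hyN
  simp only [Finset.coe_product, Finset.coe_Icc, mem_prod, mem_Icc]
  refine ⟨⟨?_, ?_⟩, ?_, ?_⟩
  · exact_mod_cast hxN.1
  · exact_mod_cast hxN.2
  · exact_mod_cast hyN.1
  · exact_mod_cast hyN.2

/-! ### Grid points in a disc -/

/-- **Roots.** The grid `ε ℤ² ⊂ ℂ` (`ε > 0`) has finitely many points in the closed disc of radius
`ρ ≥ 0` about `0`, at most `(2ρ/ε + 3)²` of them (registered sub-goal `ribbon_gridBallCount` of crux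
stmt-CriticalPhenomena-4836; elementary box count: the indices lie in `[-⌊ρ/ε⌋, ⌊ρ/ε⌋]²`). -/
theorem ribbon_gridBallCount : ∀ (ε ρ : ℝ), 0 < ε → 0 ≤ ρ → {q : ℂ | (∃ x y : ℤ, q = ε * (x + y * Complex.I)) ∧ dist q 0 ≤ ρ}.Finite ∧ (({q : ℂ | (∃ x y : ℤ, q = ε * (x + y * Complex.I)) ∧ dist q 0 ≤ ρ}.ncard : ℕ) : ℝ) ≤ (2 * ρ / ε + 3) ^ 2 := by
  intro ε ρ hε hρ
  rw [grid_setOf_eq_image ε (fun q => dist q 0 ≤ ρ)]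
  classical
  set n : ℕ := ⌊ρ / ε⌋₊ with hn
  set B : Finset (ℤ × ℤ) := Finset.Icc (-(n : ℤ)) n ×ˢ Finset.Icc (-(n : ℤ)) n with hB
  have hAB : {xy : ℤ × ℤ | dist ((ε * (xy.1 + xy.2 * Complex.I) : ℂ)) 0 ≤ ρ} ⊆ ↑B := by
    rintro ⟨x, y⟩ hxy
    simp only [mem_setOf_eq] at hxy
    rw [dist_comm] at hxy
    obtain ⟨hx, hy⟩ := abs_le_of_dist_le hε 0 ρ x y hxy
    rw [norm_zero, zero_add] at hx hy
    have hn' : (n : ℤ) = ⌊ρ / ε⌋ := by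
      rw [hn]; exact Int.natCast_floor_eq_floor (div_nonneg hρ hε.le)
    have hxn : |x| ≤ (n : ℤ) := by rw [hn', Int.le_floor]; exact_mod_cast hx
    have hyn : |y| ≤ (n : ℤ) := by rw [hn', Int.le_floor]; exact_mod_cast hy
    rw [abs_le] at hxn hyn
    simp only [hB, Finset.coe_product, Finset.coe_Icc, mem_prod, mem_Icc]
    exact ⟨hxn, hyn⟩
  have hfin := (Finset.finite_toSet B).subset hAB
  refine ⟨hfin.image _, ?_⟩
  rw [Set.ncard_image_of_injective _ (grid_injective hε)]
  have hcard : {xy : ℤ × ℤ | dist ((ε * (xy.1 + xy.2 * Complex.I) : ℂ)) 0 ≤ ρ}.ncard ≤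
      (2 * n + 1) ^ 2 := by
    calc _ ≤ (↑B : Set (ℤ × ℤ)).ncard := Set.ncard_le_ncard hAB (Finset.finite_toSet B)
      _ = B.card := Set.ncard_coe_finset B
      _ = (2 * n + 1) ^ 2 := by
        rw [hB, Finset.card_product, Int.card_Icc]
        have : (n + 1 - -(n : ℤ)).toNat = 2 * n + 1 := by omega
        rw [this, sq]
  have hnle : (n : ℝ) ≤ ρ / ε := Nat.floor_le (div_nonneg hρ hε.le)
  calc (_ : ℝ) ≤ ((2 * n + 1) ^ 2 : ℕ) := by exact_mod_cast hcard
    _ = (2 * (n : ℝ) + 1) ^ 2 := by push_cast; ring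
    _ ≤ (2 * ρ / ε + 3) ^ 2 := by
      have h2 : 2 * (n : ℝ) + 1 ≤ 2 * ρ / ε + 3 := by rw [mul_div_assoc]; linarith
      gcongr

/-! ### Grid points in a shell: the area argument -/

/-- The half-open mesh cell of index `(x, y)` is the preimage of a product of half-open intervals
under `ℂ ≃ ℝ × ℝ`. -/
private lemma cell_eq_preimage {ε : ℝ} (hε : 0 < ε) (xy : ℤ × ℤ) :
    {z : ℂ | ⌊z.re / ε⌋ = xy.1 ∧ ⌊z.im / ε⌋ = xy.2} = Complex.measurableEquivRealProd ⁻¹'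
      (Ico ((xy.1 : ℝ) * ε) ((xy.1 + 1) * ε) ×ˢ Ico ((xy.2 : ℝ) * ε) ((xy.2 + 1) * ε)) := by
  ext z
  simp only [mem_setOf_eq, mem_preimage, Complex.measurableEquivRealProd_apply, mem_prod, mem_Ico,
    Int.floor_eq_iff, le_div_iff₀ hε, div_lt_iff₀ hε]

/-- Mesh cells are measurable. -/
private lemma measurableSet_cell {ε : ℝ} (hε : 0 < ε) (xy : ℤ × ℤ) :
    MeasurableSet {z : ℂ | ⌊z.re / ε⌋ = xy.1 ∧ ⌊z.im / ε⌋ = xy.2} := by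
  rw [cell_eq_preimage hε]
  exact Complex.measurableEquivRealProd.measurable (measurableSet_Ico.prod measurableSet_Ico)

/-- Mesh cells have area `ε²`. -/
private lemma volume_cell {ε : ℝ} (hε : 0 < ε) (xy : ℤ × ℤ) :
    volume {z : ℂ | ⌊z.re / ε⌋ = xy.1 ∧ ⌊z.im / ε⌋ = xy.2} = ENNReal.ofReal (ε ^ 2) := by
  rw [cell_eq_preimage hε, Complex.volume_preserving_equiv_real_prod.measure_preimage
      ((measurableSet_Ico.prod measurableSet_Ico).nullMeasurableSet),
    Measure.volume_eq_prod, Measure.prod_prod, Real.volume_Ico, Real.volume_Ico,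
    show ((xy.1 : ℝ) + 1) * ε - xy.1 * ε = ε by ring, show ((xy.2 : ℝ) + 1) * ε - xy.2 * ε = ε by ring,
    ← ENNReal.ofReal_mul hε.le, sq]

/-- A point of the mesh cell of index `(x, y)` is within `2ε` of the grid point `ε (x + y i)`. -/
private lemma dist_lt_of_mem_cell {ε : ℝ} (hε : 0 < ε) (xy : ℤ × ℤ) {z : ℂ}
    (hz : z ∈ {z : ℂ | ⌊z.re / ε⌋ = xy.1 ∧ ⌊z.im / ε⌋ = xy.2}) :
    dist z (ε * (xy.1 + xy.2 * Complex.I)) < 2 * ε := by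
  simp only [mem_setOf_eq, Int.floor_eq_iff, le_div_iff₀ hε, div_lt_iff₀ hε] at hz
  rw [dist_eq_norm]
  refine (Complex.norm_le_abs_re_add_abs_im _).trans_lt ?_
  rw [Complex.sub_re, Complex.sub_im, grid_re, grid_im, abs_of_nonneg (by linarith),
    abs_of_nonneg (by linarith)]
  linarith

/-- **Packing bound.** A finite set of grid indices whose grid points all lie in the closed shell
`{(M-1)ε ≤ dist p · ≤ (M+1)ε}` (`M ≥ 3`) has at most `40 M` elements: the attached mesh cells are pairwise
disjoint, have area `ε²` each, and lie in the annulus `{(M-3)ε ≤ |z - p| ≤ (M+3)ε}`, whence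
`#T · ε² + π (M-3)² ε² ≤ π (M+3)² ε²`, i.e. `#T ≤ 12 π M < 40 M`. -/
private lemma card_le_of_subset_shell {ε : ℝ} (hε : 0 < ε) {M : ℕ} (hM : 3 ≤ M) (p : ℂ)
    (T : Finset (ℤ × ℤ))
    (hT : ∀ xy ∈ T, ((M : ℝ) - 1) * ε ≤ dist p (ε * (xy.1 + xy.2 * Complex.I)) ∧
      dist p (ε * (xy.1 + xy.2 * Complex.I)) ≤ ((M : ℝ) + 1) * ε) :
    T.card ≤ 40 * M := by
  obtain ⟨cell, hcell⟩ : ∃ cell : ℤ × ℤ → Set ℂ,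
      cell = fun xy => {z : ℂ | ⌊z.re / ε⌋ = xy.1 ∧ ⌊z.im / ε⌋ = xy.2} := ⟨_, rfl⟩
  have hmeas : ∀ xy, MeasurableSet (cell xy) := fun xy => by
    rw [hcell]; exact measurableSet_cell hε xy
  have hvol : ∀ xy, volume (cell xy) = ENNReal.ofReal (ε ^ 2) := fun xy => by
    rw [hcell]; exact volume_cell hε xy
  have hnear : ∀ xy, ∀ z ∈ cell xy, dist z (ε * (xy.1 + xy.2 * Complex.I)) < 2 * ε :=
    fun xy z hz => dist_lt_of_mem_cell hε xy (by rw [hcell] at hz; exact hz)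
  have hdisj : (↑T : Set (ℤ × ℤ)).PairwiseDisjoint cell := by
    intro a _ b _ hab
    rw [Function.onFun, hcell]
    exact Set.disjoint_left.2 fun z hza hzb =>
      hab (Prod.ext (hza.1.symm.trans hzb.1) (hza.2.symm.trans hzb.2))
  -- the two radii of the annulus containing the cells
  have hM' : (3 : ℝ) ≤ M := by exact_mod_cast hM
  obtain ⟨r₁, hr₁⟩ : ∃ r : ℝ, r = ((M : ℝ) - 3) * ε := ⟨_, rfl⟩
  obtain ⟨r₂, hr₂⟩ : ∃ r : ℝ, r = ((M : ℝ) + 3) * ε := ⟨_, rfl⟩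
  have hr₁0 : 0 ≤ r₁ := by rw [hr₁]; exact mul_nonneg (by linarith) hε.le
  have hr₂0 : 0 ≤ r₂ := by rw [hr₂]; positivity
  have hU_sub : (ball p r₁ ∪ ⋃ xy ∈ T, cell xy) ⊆ closedBall p r₂ := by
    refine union_subset (ball_subset_closedBall.trans (closedBall_subset_closedBall ?_)) ?_
    · rw [hr₁, hr₂]; nlinarith
    · intro z hz
      simp only [mem_iUnion, exists_prop] at hz
      obtain ⟨xy, hxyT, hz⟩ := hz
      rw [mem_closedBall]
      have h1 := hnear xy z hz
      have h2 := (hT xy hxyT).2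
      rw [dist_comm p] at h2
      calc dist z p ≤ dist z (ε * (xy.1 + xy.2 * Complex.I)) + dist (ε * (xy.1 + xy.2 * Complex.I) : ℂ) p :=
            dist_triangle _ _ _
        _ ≤ r₂ := by rw [hr₂]; linarith
  have hU_disj : Disjoint (ball p r₁) (⋃ xy ∈ T, cell xy) := by
    rw [Set.disjoint_left]
    intro z hzb hzU
    simp only [mem_iUnion, exists_prop] at hzU
    obtain ⟨xy, hxyT, hz⟩ := hzU
    rw [mem_ball, hr₁] at hzb
    have h1 := hnear xy z hz
    have h2 := (hT xy hxyT).1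
    have h3 := dist_triangle p z (ε * (xy.1 + xy.2 * Complex.I) : ℂ)
    rw [dist_comm p z] at h3
    linarith
  have hU_meas : MeasurableSet (⋃ xy ∈ T, cell xy) :=
    Finset.measurableSet_biUnion T fun xy _ => hmeas xy
  -- the measure inequality `vol (ball r₁) + #T ε² ≤ vol (closedBall r₂)`
  have hvol_le : volume (ball p r₁) + ∑ xy ∈ T, volume (cell xy) ≤ volume (closedBall p r₂) := by
    rw [← measure_biUnion_finset hdisj fun xy _ => hmeas xy, ← measure_union hU_disj hU_meas]
    exact measure_mono hU_sub
  have hpi : ((NNReal.pi : NNReal) : ℝ≥0∞) = ENNReal.ofReal π := by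
    rw [← ENNReal.ofReal_coe_nnreal, NNReal.coe_real_pi]
  have hL : volume (ball p r₁) + ∑ xy ∈ T, volume (cell xy) =
      ENNReal.ofReal (r₁ ^ 2 * π + T.card * ε ^ 2) := by
    rw [Complex.volume_ball, Finset.sum_congr rfl fun xy _ => hvol xy, Finset.sum_const, nsmul_eq_mul,
      hpi, ← ENNReal.ofReal_pow hr₁0, ← ENNReal.ofReal_mul (sq_nonneg _), ← ENNReal.ofReal_natCast,
      ← ENNReal.ofReal_mul (Nat.cast_nonneg _), ENNReal.ofReal_add (by positivity) (by positivity)]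
  have hR : volume (closedBall p r₂) = ENNReal.ofReal (r₂ ^ 2 * π) := by
    rw [Complex.volume_closedBall, hpi, ← ENNReal.ofReal_pow hr₂0, ← ENNReal.ofReal_mul (sq_nonneg _)]
  rw [hL, hR, ENNReal.ofReal_le_ofReal_iff (by positivity)] at hvol_le
  -- arithmetic: `#T ε² ≤ 12 π M ε²`, `12 π < 40`
  have hkey : (T.card : ℝ) * ε ^ 2 ≤ (12 * M * π) * ε ^ 2 := by
    have : r₂ ^ 2 * π - r₁ ^ 2 * π = (12 * M * π) * ε ^ 2 := by rw [hr₁, hr₂]; ring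
    linarith
  have hcardR : (T.card : ℝ) ≤ 12 * M * π := le_of_mul_le_mul_right hkey (by positivity)
  have h40 : (12 : ℝ) * M * π ≤ 40 * M := by
    have := Real.pi_lt_d2
    nlinarith
  exact_mod_cast hcardR.trans h40

/-- **Shell adjacency has out-degree `O(M)`.** For `ε > 0`, `M ≥ 3` and any `p ∈ ℂ`, the grid `ε ℤ²` has
finitely many points `q` with `(M-1)ε ≤ dist p q ≤ (M+1)ε`, at most `40 M` of them (registered sub-goal
`ribbon_shellCount` of crux stmt-CriticalPhenomena-4836; area/packing argument,
`card_le_of_subset_shell`). -/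
theorem ribbon_shellCount : ∀ (ε : ℝ) (M : ℕ) (p : ℂ), 0 < ε → 3 ≤ M → {q : ℂ | (∃ x y : ℤ, q = ε * (x + y * Complex.I)) ∧ ((M : ℝ) - 1) * ε ≤ dist p q ∧ dist p q ≤ ((M : ℝ) + 1) * ε}.Finite ∧ {q : ℂ | (∃ x y : ℤ, q = ε * (x + y * Complex.I)) ∧ ((M : ℝ) - 1) * ε ≤ dist p q ∧ dist p q ≤ ((M : ℝ) + 1) * ε}.ncard ≤ 40 * M := by
  intro ε M p hε hM
  rw [grid_setOf_eq_image ε (fun q => ((M : ℝ) - 1) * ε ≤ dist p q ∧ dist p q ≤ ((M : ℝ) + 1) * ε)]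
  have hAfin : {xy : ℤ × ℤ | ((M : ℝ) - 1) * ε ≤ dist p (ε * (xy.1 + xy.2 * Complex.I)) ∧
      dist p (ε * (xy.1 + xy.2 * Complex.I)) ≤ ((M : ℝ) + 1) * ε}.Finite :=
    (indexSet_finite hε p (((M : ℝ) + 1) * ε)).subset fun xy hxy => hxy.2
  refine ⟨hAfin.image _, ?_⟩
  rw [Set.ncard_image_of_injective _ (grid_injective hε), Set.ncard_eq_toFinset_card _ hAfin]
  exact card_le_of_subset_shell hε hM p hAfin.toFinset fun xy hxy =>
    (Set.Finite.mem_toFinset hAfin).1 hxy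

/-! ### Walks of bounded out-degree -/

/-- **Walk count.** If every vertex `v` has a finite "neighbour" set `nbr v` with at most `Δ` elements,
then for every start `v₀` and length `k` the set of sequences `p : Fin (k+1) → V` with `p 0 = v₀` and
`p (i+1) ∈ nbr (p i)` is finite with at most `Δ ^ k` elements (registered sub-goal `ribbon_walkCount` of
crux stmt-CriticalPhenomena-4836).  Induction on `k`: a walk of length `k+1` is `Fin.snoc` of its initial
segment (a walk of length `k`) and a neighbour of that segment's endpoint. -/
theorem ribbon_walkCount : ∀ (V : Type) (nbr : V → Set V) (Δ : ℕ), (∀ v, (nbr v).Finite ∧ (nbr v).ncard ≤ Δ) → ∀ (v₀ : V) (k : ℕ), {p : Fin (k + 1) → V | p 0 = v₀ ∧ ∀ i : Fin k, p i.succ ∈ nbr (p i.castSucc)}.Finite ∧ {p : Fin (k + 1) → V | p 0 = v₀ ∧ ∀ i : Fin k, p i.succ ∈ nbr (p i.castSucc)}.ncard ≤ Δ ^ k := by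
  intro V nbr Δ hnbr v₀ k
  classical
  induction k with
  | zero =>
    have hsub : {p : Fin (0 + 1) → V | p 0 = v₀ ∧ ∀ i : Fin 0, p i.succ ∈ nbr (p i.castSucc)} ⊆
        {fun _ => v₀} := by
      intro p hp
      rw [mem_singleton_iff]
      funext i
      rw [Fin.eq_zero i]
      exact hp.1
    refine ⟨(Set.finite_singleton _).subset hsub, ?_⟩
    calc _ ≤ ({fun _ => v₀} : Set (Fin (0 + 1) → V)).ncard :=
          Set.ncard_le_ncard hsub (Set.finite_singleton _)
      _ = 1 := Set.ncard_singleton _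
      _ = Δ ^ 0 := (pow_zero Δ).symm
  | succ k ih =>
    obtain ⟨hfin, hcard⟩ := ih
    -- extensions of a length-`k` walk `q` by a neighbour of its endpoint
    set ext : (Fin (k + 1) → V) → Finset (Fin (k + 1 + 1) → V) := fun q =>
      (hnbr (q (Fin.last k))).1.toFinset.image fun v => (Fin.snoc q v : Fin (k + 1 + 1) → V) with hext
    have hext_card : ∀ q, (ext q).card ≤ Δ := fun q =>
      calc (ext q).card ≤ (hnbr (q (Fin.last k))).1.toFinset.card := Finset.card_image_le
        _ = (nbr (q (Fin.last k))).ncard := (Set.ncard_eq_toFinset_card _ _).symm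
        _ ≤ Δ := (hnbr _).2
    have hsub : {p : Fin (k + 1 + 1) → V | p 0 = v₀ ∧ ∀ i : Fin (k + 1), p i.succ ∈ nbr (p i.castSucc)} ⊆
        ↑(hfin.toFinset.biUnion ext) := by
      intro p hp
      obtain ⟨hp0, hstep⟩ := hp
      rw [Finset.mem_coe, Finset.mem_biUnion]
      refine ⟨Fin.init p, ?_, ?_⟩
      · rw [Set.Finite.mem_toFinset]
        refine ⟨?_, fun i => ?_⟩
        · simpa [Fin.init] using hp0
        · exact hstep i.castSucc
      · rw [hext, Finset.mem_image]
        refine ⟨p (Fin.last (k + 1)), ?_, Fin.snoc_init_self p⟩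
        rw [Set.Finite.mem_toFinset]
        exact hstep (Fin.last k)
    refine ⟨(Finset.finite_toSet _).subset hsub, ?_⟩
    calc _ ≤ (↑(hfin.toFinset.biUnion ext) : Set (Fin (k + 1 + 1) → V)).ncard :=
          Set.ncard_le_ncard hsub (Finset.finite_toSet _)
      _ = (hfin.toFinset.biUnion ext).card := Set.ncard_coe_finset _
      _ ≤ ∑ q ∈ hfin.toFinset, (ext q).card := Finset.card_biUnion_le
      _ ≤ ∑ _q ∈ hfin.toFinset, Δ := Finset.sum_le_sum fun q _ => hext_card q
      _ = hfin.toFinset.card * Δ := by rw [Finset.sum_const, smul_eq_mul]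
      _ ≤ Δ ^ k * Δ := by
        gcongr
        rwa [← Set.ncard_eq_toFinset_card _ hfin]
      _ = Δ ^ (k + 1) := (pow_succ Δ k).symm

end Summit.CriticalPhenomena.CardyFormulaZ2.Cruxes.MagicFormulaT.LineSketch

end
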